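import Summits.Ventures.HodgeRepro2.T6A2Hyp
import Summits.Ventures.HodgeRepro2.A2Denominators

/-!
# T6A2LefProofs — TIER4 Prop. A4.2.4 from the displayed Voisin statements: an integral (1,1)-class on a
projective manifold is the class of a divisor, and a rational (1,1)-class lies in the ℚ-span of divisor classes

Cell pub-hodge-repro2, Tier 6 (README §10), seat t6-p2 (A2 owner). Proof lane. TIER4 Prop. A4.2.4 reached
"3E = cl(D₁) − cl(D₂)" through Lange's chain (Prop. 1.2.9, Lemma 1.2.10, Prop. 2.1.11, Cor. 2.1.12, Bertini,
Voisin Thm. 11.33, Rem. 11.16 — TIER4 A2 E22–E36); here the same conclusion ("H²(X, ℚ) ∩ H^{1,1}(X) ⊂ Alg²(X)",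
with Alg² = the ℚ-span of the classes of divisors) is derived from the two displayed statements
`Hyp.Voisin2002_Thm11_30` and `Hyp.Voisin2002_Cor11_34` alone, plus the clearing of denominators (p6's
ACCEPTED `A2Denominators.exists_nsmul_eq_one_tmul`, TIER4 A4.2.4 Conclusion). The identification of
Voisin's class of a divisor with Fulton's cycle class (TIER4 A2 GAPS (i)) is NOT made here: it is the
identification datum of Layer III. `toyLef` / `toyLef_hyps` = the §10.5(ii) joint-satisfiability witness.
§8(d): uses an L-value-free non-vanishing device: NO.
-/

namespace Summit.Ventures.HodgeRepro2.T6.A2LefProofs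

open Summit.Ventures.HodgeRepro2.T6.A2LefCarrier Summit.Ventures.HodgeRepro2.T6.Hyp

universe u

variable (T : LefschetzCarrier.{u})

/-- `toCQ (1 ⊗ m) = toC m`. -/
theorem toCQ_toQ (X : T.Space) (m : T.H2Z X) : T.toCQ X (T.toQ X m) = T.toC X m := by
  simp [LefschetzCarrier.toCQ, LefschetzCarrier.toQ, LefschetzCarrier.toCQbil]

/-- `toCQ` commutes with natural multiples. -/
theorem toCQ_nsmul (X : T.Space) (n : ℕ) (q : T.H2Q X) : T.toCQ X (n • q) = n • T.toCQ X q :=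
  map_nsmul _ _ _

/-- Lefschetz (1,1) on a projective manifold, integral form (Voisin Thm. 11.30 + Cor. 11.34): an integral class
of type (1,1) is the class of a divisor. -/
theorem exists_div_of_oneOne (h30 : Voisin2002_Thm11_30 T) (h34 : Voisin2002_Cor11_34 T) (X : T.Space)
    (hX : T.IsProjective X) {c : T.H2Z X} (hc : T.toC X c ∈ T.H11 X) : ∃ D : T.Div X, T.clDiv X D = c := by
  have h1 : c ∈ Set.range (T.c1 X) := by rw [← h30 X]; exact hc
  rw [h34 X hX] at h1
  exact h1

/-- TIER4 Prop. A4.2.4, rational form: a rational class of type (1,1) on a projective manifold lies in the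
ℚ-span of the classes of divisors (`Alg²(X)` in the normalisation "classes of codimension-1 cycles"). -/
theorem mem_span_div_of_oneOne (h30 : Voisin2002_Thm11_30 T) (h34 : Voisin2002_Cor11_34 T) (X : T.Space)
    (hX : T.IsProjective X) {q : T.H2Q X} (hq : T.toCQ X q ∈ T.H11 X) :
    q ∈ Submodule.span ℚ (Set.range fun D : T.Div X => T.toQ X (T.clDiv X D)) := by
  obtain ⟨n, hn, m, hm⟩ := Summit.Ventures.HodgeRepro2.A2Denominators.exists_nsmul_eq_one_tmul q
  have hmC : T.toC X m ∈ T.H11 X := by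
    rw [← toCQ_toQ, LefschetzCarrier.toQ, ← hm, toCQ_nsmul]
    exact (T.H11 X).toAddSubmonoid.nsmul_mem hq n
  obtain ⟨D, hD⟩ := exists_div_of_oneOne T h30 h34 X hX hmC
  have hq' : q = ((n : ℚ)⁻¹) • T.toQ X (T.clDiv X D) := by
    rw [hD, LefschetzCarrier.toQ, ← hm, ← Nat.cast_smul_eq_nsmul ℚ, smul_smul,
      inv_mul_cancel₀ (by exact_mod_cast hn.ne'), one_smul]
  rw [hq']
  exact Submodule.smul_mem _ _ (Submodule.subset_span ⟨D, rfl⟩)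


/-- The toy carrier for the non-vacuity protocol (README §10.5(ii)(c),(d); TARGET-T6 §7(f)): one space,
`H²(ℤ) = ℤ`, `H²(ℂ) = ℂ` with `H^{1,1} = ℂ`, `Pic = Div = ℤ`, `c₁ = [·] = id`. Both displays hold on it; it is
a consistency witness only, not a variety. -/
noncomputable def toyLef : LefschetzCarrier.{0} where
  Space := Unit
  IsProjective := fun _ => True
  H2Z := fun _ => ℤ
  H2C := fun _ => ℂ
  toC := fun _ => Int.castAddHom ℂ
  H11 := fun _ => ⊤
  Pic := fun _ => ℤ
  c1 := fun _ => id
  Div := fun _ => ℤ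
  clDiv := fun _ => id

/-- The two displays hold jointly on the toy carrier (README §10.5(ii)(d)). -/
theorem toyLef_hyps : Voisin2002_Thm11_30 toyLef ∧ Voisin2002_Cor11_34 toyLef := by
  refine ⟨fun _ => ?_, fun _ _ => ?_⟩
  · ext c
    refine ⟨fun _ => ⟨c, rfl⟩, fun _ => ?_⟩
    show (Int.castAddHom ℂ) c ∈ (⊤ : Submodule ℂ ℂ)
    exact Submodule.mem_top
  · rfl

end Summit.Ventures.HodgeRepro2.T6.A2LefProofs
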